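import Summits.Parity.GeneralizedHardyLittlewood.Theorems.PrimeLevelFamEdgeMomentsBeyondDiagonalDiagGenericPolyClosure
import HarnessLib

/-!
# Route `PrimeLevelFamEdge`, crux K_A `MomentsBeyondDiagonal` (stmt-Parity-20007), line «petersson_layers» v4, stub `stub_diag`:
# **the GENERIC polynomial side (Poly_ij) of EVERY order `(i,j)`: `Sel_M(poly_ij) = 𝔎·log^{i+j}M/log²M + O(log^{i+j}M/log³M)`
# for SOME level-free `𝔎`, for ALL Bose constants**

Third brick of the generic assembly (G3′) (census `Cruxes/MomentsBeyondDiagonal/Lines/petersson_layers_stub_diag_g18_generic.md`).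
The order-`(i,j)` weight after the Hecke summation (`…DiagDecorOrderHecke.heckeSum_order_eq i j`) is
`Σ_{a≤i,b≤j} C(i,a)C(j,b)·W_{i−a,j−b}(L;k₁,k₂)·c_{ab}(y)`; its POLYNOMIAL PART replaces each Bose coefficient `c_{ab}(y)` by
`E_{ab} + Σ_{i′≤a,j′≤b} C(a,i′)C(b,j′)((−1)^{j′}+(−1)^{i′})μ_{i′+j′}(−1/2)^N L^{N+1}/(N+1)` (`N = a−i′+b−j′`; the `Π`-form of
`…DiagRemBoseTwoSeq.abs_doubleSum_bose_rem_le₂ a b`, constants `E : ℕ → ℕ → ℝ`, `μ : ℕ → ℝ` ARBITRARY here). With the closure lemmas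
of `…DiagGenericPolyClosure` and the generic monomial `…DiagGenericMonomial.exists_selbergHeckeHecke_Lpow_asymp`:

* `selbergAsymp_Wblock_Lpow` — **`Sel_M(W_{p,q}(L;k₁,k₂)·L^n)` has the shape with exponent `e` whenever `p + q + n ≤ e + 1`**;
* `selbergAsymp_orderPoly` — **(Poly_ij) for EVERY `(i,j)`, every `P` with `P₀ = P₁ = 0`, every `λ ∈ [0,1]`, all constants `E, μ`**
  (exponent `e = i + j`).

Def-free; theorems only. Helper `--supports stmt-Parity-20007`; closes nothing; K_A, K_B and the Parity summit are NOT proved;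
nothing about Landau–Siegel zeros.

## References
* E. Kowalski, P. Michel, J. VanderKam, J. reine angew. Math. 526 (2000), (23)–(28) pp. 13–15 and Prop. 5.1 p. 18.
  [cite: KowalskiMichelVanderKam2000, (23)–(28) — derivation (polynomial part of the order-(i,j) diagonal weight)]
-/

noncomputable section

open scoped Real ArithmeticFunction.Moebius
open Finset ArithmeticFunction Polynomial MeasureTheory intervalIntegral

namespace Summit.Parity.GeneralizedHardyLittlewood.Theorems.MomentsBeyondDiagonal.DiagKernel

open Literature.NumberTheory.LFunctions Literature.NumberTheory.LFunctions.KMV2000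

variable (P : ℝ[X])

/-! ### The `W_{p,q}·L^n` block and the polynomial side of order `(i,j)` -/

set_option maxHeartbeats 1600000 in
/-- **`Sel_M(W_{p,q}(L;k₁,k₂)·L^n)` has the shape `K·log^eM/log²M + O(log^eM/log³M)` whenever `p + q + n ≤ e + 1`**
(`W_{p,q}` = the arithmetic factor of `…DiagDecorOrderHecke.heckeSum_order_eq`; `P₀ = P₁ = 0`, `0 ≤ λ ≤ 1`).
[cite: KowalskiMichelVanderKam2000, (23)–(28) — derivation (polynomial part of the diagonal weight)] -/
theorem selbergAsymp_Wblock_Lpow (p q n e : ℕ) (hpqn : p + q + n ≤ e + 1)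
    (hP0 : P.coeff 0 = 0) (hP1 : P.coeff 1 = 0) {lam : ℝ} (hlam0 : 0 ≤ lam) (hlam1 : lam ≤ 1) :
    ∃ K C : ℝ, ∀ M : ℝ, 3 ≤ M →
      |∑ c ∈ Icc 1 ⌊M⌋₊, ∑ g ∈ Icc 1 (⌊M⌋₊ / c), (μ g : ℝ) * c *
          ∑ k₁ ∈ Icc 1 (⌊M⌋₊ / (c * g)), ∑ k₂ ∈ Icc 1 (⌊M⌋₊ / (c * g)),
            ((μ (c * g * k₁) : ℝ) * ((psi (c * g * k₁))⁻¹ *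
                P.eval (Real.log (M / ((c * g * k₁ : ℕ) : ℝ)) / Real.log M))) / ((c * g * k₁ : ℕ) : ℝ) *
              (((μ (c * g * k₂) : ℝ) * ((psi (c * g * k₂))⁻¹ *
                P.eval (Real.log (M / ((c * g * k₂ : ℕ) : ℝ)) / Real.log M))) / ((c * g * k₂ : ℕ) : ℝ)) *
              (((1 / 2) ^ (p + (q)) * ∑ r ∈ range (p + 1), ∑ s ∈ range (q + 1),
                  ((p).choose r : ℝ) * ((q).choose s) * (-1) ^ s *
                      (2 * (lam * Real.log M) - 2 * Real.log g - Real.log k₁ - Real.log k₂) ^ (p - r + (q - s)) *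
                    ∑ t ∈ range (r + s + 1), ((r + s).choose t : ℝ) *
                      ((∑ d ∈ k₁.divisors, (2 * Real.log d - Real.log k₁) ^ t) *
                        ∑ e ∈ k₂.divisors, (2 * Real.log e - Real.log k₂) ^ (r + s - t))) * (2 * (lam * Real.log M) - 2 * Real.log g - Real.log k₁ - Real.log k₂) ^ n) -
        K * Real.log M ^ (e) / Real.log M ^ 2| ≤ C * Real.log M ^ (e) / Real.log M ^ 3 := by
  -- the block as a triple sum of generic monomials
  have hpt : ∀ (M : ℝ) (c g k₁ k₂ : ℕ),
      (1 / 2 : ℝ) ^ (p + q) * ∑ r ∈ range (p + 1), ∑ s ∈ range (q + 1), ∑ t ∈ range (r + s + 1),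
        ((p.choose r : ℝ) * (q.choose s) * (-1) ^ s * ((r + s).choose t : ℝ)) *
          ((∑ d ∈ k₁.divisors, (2 * Real.log d - Real.log k₁) ^ t) *
            (∑ d ∈ k₂.divisors, (2 * Real.log d - Real.log k₂) ^ (r + s - t)) *
            (2 * (lam * Real.log M) - 2 * Real.log g - Real.log k₁ - Real.log k₂) ^ (p - r + (q - s) + n)) =
      ((1 / 2) ^ (p + (q)) * ∑ r ∈ range (p + 1), ∑ s ∈ range (q + 1),
                  ((p).choose r : ℝ) * ((q).choose s) * (-1) ^ s *
                      (2 * (lam * Real.log M) - 2 * Real.log g - Real.log k₁ - Real.log k₂) ^ (p - r + (q - s)) *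
                    ∑ t ∈ range (r + s + 1), ((r + s).choose t : ℝ) *
                      ((∑ d ∈ k₁.divisors, (2 * Real.log d - Real.log k₁) ^ t) *
                        ∑ e ∈ k₂.divisors, (2 * Real.log e - Real.log k₂) ^ (r + s - t))) *
                (2 * (lam * Real.log M) - 2 * Real.log g - Real.log k₁ - Real.log k₂) ^ n := by
    intro M _ g k₁ k₂
    rw [mul_assoc ((1 / 2 : ℝ) ^ (p + q)), Finset.sum_mul]
    congr 1
    refine Finset.sum_congr rfl fun r _ ↦ ?_
    rw [Finset.sum_mul]
    refine Finset.sum_congr rfl fun s _ ↦ ?_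
    rw [Finset.mul_sum, Finset.sum_mul]
    refine Finset.sum_congr rfl fun t _ ↦ ?_
    ring
  refine selbergAsymp_congr P e _ _ hpt ?_
  refine selbergAsymp_const_mul P e ((1 / 2 : ℝ) ^ (p + q)) (fun M c g k₁ k₂ ↦
    ∑ r ∈ range (p + 1), ∑ s ∈ range (q + 1), ∑ t ∈ range (r + s + 1),
        ((p.choose r : ℝ) * (q.choose s) * (-1) ^ s * ((r + s).choose t : ℝ)) *
          ((∑ d ∈ k₁.divisors, (2 * Real.log d - Real.log k₁) ^ t) *
            (∑ d ∈ k₂.divisors, (2 * Real.log d - Real.log k₂) ^ (r + s - t)) *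
            (2 * (lam * Real.log M) - 2 * Real.log g - Real.log k₁ - Real.log k₂) ^ (p - r + (q - s) + n))) ?_
  refine selbergAsymp_finset_sum P e (range (p + 1)) (fun r M c g k₁ k₂ ↦
    ∑ s ∈ range (q + 1), ∑ t ∈ range (r + s + 1),
        ((p.choose r : ℝ) * (q.choose s) * (-1) ^ s * ((r + s).choose t : ℝ)) *
          ((∑ d ∈ k₁.divisors, (2 * Real.log d - Real.log k₁) ^ t) *
            (∑ d ∈ k₂.divisors, (2 * Real.log d - Real.log k₂) ^ (r + s - t)) *
            (2 * (lam * Real.log M) - 2 * Real.log g - Real.log k₁ - Real.log k₂) ^ (p - r + (q - s) + n))) fun r hr ↦ ?_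
  refine selbergAsymp_finset_sum P e (range (q + 1)) (fun s M c g k₁ k₂ ↦
    ∑ t ∈ range (r + s + 1),
        ((p.choose r : ℝ) * (q.choose s) * (-1) ^ s * ((r + s).choose t : ℝ)) *
          ((∑ d ∈ k₁.divisors, (2 * Real.log d - Real.log k₁) ^ t) *
            (∑ d ∈ k₂.divisors, (2 * Real.log d - Real.log k₂) ^ (r + s - t)) *
            (2 * (lam * Real.log M) - 2 * Real.log g - Real.log k₁ - Real.log k₂) ^ (p - r + (q - s) + n))) fun s hs ↦ ?_
  refine selbergAsymp_finset_sum P e (range (r + s + 1)) (fun t M c g k₁ k₂ ↦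
        ((p.choose r : ℝ) * (q.choose s) * (-1) ^ s * ((r + s).choose t : ℝ)) *
          ((∑ d ∈ k₁.divisors, (2 * Real.log d - Real.log k₁) ^ t) *
            (∑ d ∈ k₂.divisors, (2 * Real.log d - Real.log k₂) ^ (r + s - t)) *
            (2 * (lam * Real.log M) - 2 * Real.log g - Real.log k₁ - Real.log k₂) ^ (p - r + (q - s) + n))) fun t ht ↦ ?_
  refine selbergAsymp_const_mul P e _ (fun M c g k₁ k₂ ↦
          ((∑ d ∈ k₁.divisors, (2 * Real.log d - Real.log k₁) ^ t) *
            (∑ d ∈ k₂.divisors, (2 * Real.log d - Real.log k₂) ^ (r + s - t)) *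
            (2 * (lam * Real.log M) - 2 * Real.log g - Real.log k₁ - Real.log k₂) ^ (p - r + (q - s) + n))) ?_
  have hr' := Finset.mem_range.1 hr
  have hs' := Finset.mem_range.1 hs
  have ht' := Finset.mem_range.1 ht
  exact exists_selbergHeckeHecke_Lpow_asymp P t (r + s - t) (p - r + (q - s) + n) e (by omega) hP0 hP1 hlam0 hlam1

set_option maxHeartbeats 3200000 in
/-- **(Poly_ij) for EVERY order `(i,j)`**: for every `P` with `P₀ = P₁ = 0`, every `λ ∈ [0,1]` and ALL constants `E : ℕ → ℕ → ℝ`,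
`μ : ℕ → ℝ`, the Selberg form of the polynomial part of the order-`(i,j)` weight has the shape `𝔎·log^{i+j}M/log²M + O(log^{i+j}M/log³M)`
for all `M ≥ 3` (see the module docstring). [cite: KowalskiMichelVanderKam2000, (23)–(28) and Prop. 5.1 — derivation (polynomial part of the order-(i,j) diagonal weight)] -/
theorem selbergAsymp_orderPoly (i j : ℕ) (hP0 : P.coeff 0 = 0) (hP1 : P.coeff 1 = 0) {lam : ℝ} (hlam0 : 0 ≤ lam)
    (hlam1 : lam ≤ 1) (E : ℕ → ℕ → ℝ) (mu : ℕ → ℝ) :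
    ∃ K C : ℝ, ∀ M : ℝ, 3 ≤ M →
      |∑ c ∈ Icc 1 ⌊M⌋₊, ∑ g ∈ Icc 1 (⌊M⌋₊ / c), (μ g : ℝ) * c *
          ∑ k₁ ∈ Icc 1 (⌊M⌋₊ / (c * g)), ∑ k₂ ∈ Icc 1 (⌊M⌋₊ / (c * g)),
            ((μ (c * g * k₁) : ℝ) * ((psi (c * g * k₁))⁻¹ *
                P.eval (Real.log (M / ((c * g * k₁ : ℕ) : ℝ)) / Real.log M))) / ((c * g * k₁ : ℕ) : ℝ) *
              (((μ (c * g * k₂) : ℝ) * ((psi (c * g * k₂))⁻¹ *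
                P.eval (Real.log (M / ((c * g * k₂ : ℕ) : ℝ)) / Real.log M))) / ((c * g * k₂ : ℕ) : ℝ)) *
              (∑ a ∈ range (i + 1), ∑ b ∈ range (j + 1),
                (i.choose a : ℝ) * (j.choose b) *
                ((1 / 2) ^ (i - a + (j - b)) * ∑ r ∈ range (i - a + 1), ∑ s ∈ range (j - b + 1),
                  ((i - a).choose r : ℝ) * ((j - b).choose s) * (-1) ^ s *
                      (2 * (lam * Real.log M) - 2 * Real.log g - Real.log k₁ - Real.log k₂) ^ (i - a - r + (j - b - s)) *
                    ∑ t ∈ range (r + s + 1), ((r + s).choose t : ℝ) *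
                      ((∑ d ∈ k₁.divisors, (2 * Real.log d - Real.log k₁) ^ t) *
                        ∑ e ∈ k₂.divisors, (2 * Real.log e - Real.log k₂) ^ (r + s - t))) *
                (E a b + (∑ i' ∈ Finset.range (a + 1), ∑ j' ∈ Finset.range (b + 1),
                  ((a).choose i' : ℝ) * ((b).choose j' : ℝ) * ((-1) ^ j' + (-1) ^ i') * mu (i' + j') *
                    ((-1 / 2 : ℝ) ^ (a - i' + (b - j')) * (2 * (lam * Real.log M) - 2 * Real.log g - Real.log k₁ - Real.log k₂) ^ (a - i' + (b - j') + 1) /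
                      (((a - i' + (b - j') : ℕ) : ℝ) + 1))))) -
        K * Real.log M ^ (i + j) / Real.log M ^ 2| ≤ C * Real.log M ^ (i + j) / Real.log M ^ 3 := by
  refine selbergAsymp_finset_sum P (i + j) (range (i + 1)) (fun a M c g k₁ k₂ ↦ ∑ b ∈ range (j + 1),
                (i.choose a : ℝ) * (j.choose b) *
                ((1 / 2) ^ (i - a + (j - b)) * ∑ r ∈ range (i - a + 1), ∑ s ∈ range (j - b + 1),
                  ((i - a).choose r : ℝ) * ((j - b).choose s) * (-1) ^ s *
                      (2 * (lam * Real.log M) - 2 * Real.log g - Real.log k₁ - Real.log k₂) ^ (i - a - r + (j - b - s)) *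
                    ∑ t ∈ range (r + s + 1), ((r + s).choose t : ℝ) *
                      ((∑ d ∈ k₁.divisors, (2 * Real.log d - Real.log k₁) ^ t) *
                        ∑ e ∈ k₂.divisors, (2 * Real.log e - Real.log k₂) ^ (r + s - t))) *
                (E a b + (∑ i' ∈ Finset.range (a + 1), ∑ j' ∈ Finset.range (b + 1),
                  ((a).choose i' : ℝ) * ((b).choose j' : ℝ) * ((-1) ^ j' + (-1) ^ i') * mu (i' + j') *
                    ((-1 / 2 : ℝ) ^ (a - i' + (b - j')) * (2 * (lam * Real.log M) - 2 * Real.log g - Real.log k₁ - Real.log k₂) ^ (a - i' + (b - j') + 1) /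
                      (((a - i' + (b - j') : ℕ) : ℝ) + 1))))) fun a ha ↦ ?_
  refine selbergAsymp_finset_sum P (i + j) (range (j + 1)) (fun b M c g k₁ k₂ ↦
                (i.choose a : ℝ) * (j.choose b) *
                ((1 / 2) ^ (i - a + (j - b)) * ∑ r ∈ range (i - a + 1), ∑ s ∈ range (j - b + 1),
                  ((i - a).choose r : ℝ) * ((j - b).choose s) * (-1) ^ s *
                      (2 * (lam * Real.log M) - 2 * Real.log g - Real.log k₁ - Real.log k₂) ^ (i - a - r + (j - b - s)) *
                    ∑ t ∈ range (r + s + 1), ((r + s).choose t : ℝ) *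
                      ((∑ d ∈ k₁.divisors, (2 * Real.log d - Real.log k₁) ^ t) *
                        ∑ e ∈ k₂.divisors, (2 * Real.log e - Real.log k₂) ^ (r + s - t))) *
                (E a b + (∑ i' ∈ Finset.range (a + 1), ∑ j' ∈ Finset.range (b + 1),
                  ((a).choose i' : ℝ) * ((b).choose j' : ℝ) * ((-1) ^ j' + (-1) ^ i') * mu (i' + j') *
                    ((-1 / 2 : ℝ) ^ (a - i' + (b - j')) * (2 * (lam * Real.log M) - 2 * Real.log g - Real.log k₁ - Real.log k₂) ^ (a - i' + (b - j') + 1) /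
                      (((a - i' + (b - j') : ℕ) : ℝ) + 1))))) fun b hb ↦ ?_
  have ha' := Finset.mem_range.1 ha
  have hb' := Finset.mem_range.1 hb
  -- the `(a,b)` term as `(C C E)·(W·L^0) + Σ_{i′,j′} coef·(W·L^{N+1})`
  have hpt : ∀ (M : ℝ) (c g k₁ k₂ : ℕ),
      ((i.choose a : ℝ) * (j.choose b) * E a b) *
          (((1 / 2) ^ (i - a + (j - b)) * ∑ r ∈ range (i - a + 1), ∑ s ∈ range (j - b + 1),
                  ((i - a).choose r : ℝ) * ((j - b).choose s) * (-1) ^ s *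
                      (2 * (lam * Real.log M) - 2 * Real.log g - Real.log k₁ - Real.log k₂) ^ (i - a - r + (j - b - s)) *
                    ∑ t ∈ range (r + s + 1), ((r + s).choose t : ℝ) *
                      ((∑ d ∈ k₁.divisors, (2 * Real.log d - Real.log k₁) ^ t) *
                        ∑ e ∈ k₂.divisors, (2 * Real.log e - Real.log k₂) ^ (r + s - t))) *
            (2 * (lam * Real.log M) - 2 * Real.log g - Real.log k₁ - Real.log k₂) ^ 0) +
        ∑ i' ∈ Finset.range (a + 1), ∑ j' ∈ Finset.range (b + 1),
          ((i.choose a : ℝ) * (j.choose b) * ((a.choose i' : ℝ) * (b.choose j' : ℝ) * ((-1) ^ j' + (-1) ^ i') *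
              mu (i' + j') * ((-1 / 2 : ℝ) ^ (a - i' + (b - j')) / (((a - i' + (b - j') : ℕ) : ℝ) + 1)))) *
            (((1 / 2) ^ (i - a + (j - b)) * ∑ r ∈ range (i - a + 1), ∑ s ∈ range (j - b + 1),
                  ((i - a).choose r : ℝ) * ((j - b).choose s) * (-1) ^ s *
                      (2 * (lam * Real.log M) - 2 * Real.log g - Real.log k₁ - Real.log k₂) ^ (i - a - r + (j - b - s)) *
                    ∑ t ∈ range (r + s + 1), ((r + s).choose t : ℝ) *
                      ((∑ d ∈ k₁.divisors, (2 * Real.log d - Real.log k₁) ^ t) *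
                        ∑ e ∈ k₂.divisors, (2 * Real.log e - Real.log k₂) ^ (r + s - t))) *
              (2 * (lam * Real.log M) - 2 * Real.log g - Real.log k₁ - Real.log k₂) ^ (a - i' + (b - j') + 1)) =
      (i.choose a : ℝ) * (j.choose b) *
                ((1 / 2) ^ (i - a + (j - b)) * ∑ r ∈ range (i - a + 1), ∑ s ∈ range (j - b + 1),
                  ((i - a).choose r : ℝ) * ((j - b).choose s) * (-1) ^ s *
                      (2 * (lam * Real.log M) - 2 * Real.log g - Real.log k₁ - Real.log k₂) ^ (i - a - r + (j - b - s)) *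
                    ∑ t ∈ range (r + s + 1), ((r + s).choose t : ℝ) *
                      ((∑ d ∈ k₁.divisors, (2 * Real.log d - Real.log k₁) ^ t) *
                        ∑ e ∈ k₂.divisors, (2 * Real.log e - Real.log k₂) ^ (r + s - t))) *
                (E a b + (∑ i' ∈ Finset.range (a + 1), ∑ j' ∈ Finset.range (b + 1),
                  ((a).choose i' : ℝ) * ((b).choose j' : ℝ) * ((-1) ^ j' + (-1) ^ i') * mu (i' + j') *
                    ((-1 / 2 : ℝ) ^ (a - i' + (b - j')) * (2 * (lam * Real.log M) - 2 * Real.log g - Real.log k₁ - Real.log k₂) ^ (a - i' + (b - j') + 1) /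
                      (((a - i' + (b - j') : ℕ) : ℝ) + 1)))) := by
    intro M _ g k₁ k₂
    rw [mul_add _ (E a b)]
    congr 1
    · ring
    · rw [Finset.mul_sum (Finset.range (a + 1))]
      refine Finset.sum_congr rfl fun i' _ ↦ ?_
      rw [Finset.mul_sum (Finset.range (b + 1))]
      refine Finset.sum_congr rfl fun j' _ ↦ ?_
      ring
  refine selbergAsymp_congr P (i + j) _ _ hpt ?_
  refine selbergAsymp_add P (i + j) _ _ ?_ ?_
  · refine selbergAsymp_const_mul P (i + j) _ (fun M c g k₁ k₂ ↦
          (((1 / 2) ^ (i - a + (j - b)) * ∑ r ∈ range (i - a + 1), ∑ s ∈ range (j - b + 1),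
                  ((i - a).choose r : ℝ) * ((j - b).choose s) * (-1) ^ s *
                      (2 * (lam * Real.log M) - 2 * Real.log g - Real.log k₁ - Real.log k₂) ^ (i - a - r + (j - b - s)) *
                    ∑ t ∈ range (r + s + 1), ((r + s).choose t : ℝ) *
                      ((∑ d ∈ k₁.divisors, (2 * Real.log d - Real.log k₁) ^ t) *
                        ∑ e ∈ k₂.divisors, (2 * Real.log e - Real.log k₂) ^ (r + s - t))) *
            (2 * (lam * Real.log M) - 2 * Real.log g - Real.log k₁ - Real.log k₂) ^ 0)) ?_
    exact selbergAsymp_Wblock_Lpow P (i - a) (j - b) 0 (i + j) (by omega) hP0 hP1 hlam0 hlam1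
  · refine selbergAsymp_finset_sum P (i + j) (Finset.range (a + 1)) (fun i' M c g k₁ k₂ ↦ ∑ j' ∈ Finset.range (b + 1),
          ((i.choose a : ℝ) * (j.choose b) * ((a.choose i' : ℝ) * (b.choose j' : ℝ) * ((-1) ^ j' + (-1) ^ i') *
              mu (i' + j') * ((-1 / 2 : ℝ) ^ (a - i' + (b - j')) / (((a - i' + (b - j') : ℕ) : ℝ) + 1)))) *
            (((1 / 2) ^ (i - a + (j - b)) * ∑ r ∈ range (i - a + 1), ∑ s ∈ range (j - b + 1),
                  ((i - a).choose r : ℝ) * ((j - b).choose s) * (-1) ^ s *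
                      (2 * (lam * Real.log M) - 2 * Real.log g - Real.log k₁ - Real.log k₂) ^ (i - a - r + (j - b - s)) *
                    ∑ t ∈ range (r + s + 1), ((r + s).choose t : ℝ) *
                      ((∑ d ∈ k₁.divisors, (2 * Real.log d - Real.log k₁) ^ t) *
                        ∑ e ∈ k₂.divisors, (2 * Real.log e - Real.log k₂) ^ (r + s - t))) *
              (2 * (lam * Real.log M) - 2 * Real.log g - Real.log k₁ - Real.log k₂) ^ (a - i' + (b - j') + 1))) fun i' hi' ↦ ?_
    refine selbergAsymp_finset_sum P (i + j) (Finset.range (b + 1)) (fun j' M c g k₁ k₂ ↦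
          ((i.choose a : ℝ) * (j.choose b) * ((a.choose i' : ℝ) * (b.choose j' : ℝ) * ((-1) ^ j' + (-1) ^ i') *
              mu (i' + j') * ((-1 / 2 : ℝ) ^ (a - i' + (b - j')) / (((a - i' + (b - j') : ℕ) : ℝ) + 1)))) *
            (((1 / 2) ^ (i - a + (j - b)) * ∑ r ∈ range (i - a + 1), ∑ s ∈ range (j - b + 1),
                  ((i - a).choose r : ℝ) * ((j - b).choose s) * (-1) ^ s *
                      (2 * (lam * Real.log M) - 2 * Real.log g - Real.log k₁ - Real.log k₂) ^ (i - a - r + (j - b - s)) *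
                    ∑ t ∈ range (r + s + 1), ((r + s).choose t : ℝ) *
                      ((∑ d ∈ k₁.divisors, (2 * Real.log d - Real.log k₁) ^ t) *
                        ∑ e ∈ k₂.divisors, (2 * Real.log e - Real.log k₂) ^ (r + s - t))) *
              (2 * (lam * Real.log M) - 2 * Real.log g - Real.log k₁ - Real.log k₂) ^ (a - i' + (b - j') + 1))) fun j' hj' ↦ ?_
    refine selbergAsymp_const_mul P (i + j) _ (fun M c g k₁ k₂ ↦
            (((1 / 2) ^ (i - a + (j - b)) * ∑ r ∈ range (i - a + 1), ∑ s ∈ range (j - b + 1),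
                  ((i - a).choose r : ℝ) * ((j - b).choose s) * (-1) ^ s *
                      (2 * (lam * Real.log M) - 2 * Real.log g - Real.log k₁ - Real.log k₂) ^ (i - a - r + (j - b - s)) *
                    ∑ t ∈ range (r + s + 1), ((r + s).choose t : ℝ) *
                      ((∑ d ∈ k₁.divisors, (2 * Real.log d - Real.log k₁) ^ t) *
                        ∑ e ∈ k₂.divisors, (2 * Real.log e - Real.log k₂) ^ (r + s - t))) *
              (2 * (lam * Real.log M) - 2 * Real.log g - Real.log k₁ - Real.log k₂) ^ (a - i' + (b - j') + 1))) ?_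
    have hi'' := Finset.mem_range.1 hi'
    have hj'' := Finset.mem_range.1 hj'
    exact selbergAsymp_Wblock_Lpow P (i - a) (j - b) (a - i' + (b - j') + 1) (i + j) (by omega) hP0 hP1 hlam0 hlam1

end Summit.Parity.GeneralizedHardyLittlewood.Theorems.MomentsBeyondDiagonal.DiagKernel

end
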